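import Summits.AtomisticToContinuum.HydrodynamicLimit.Theorems.CollisionIsometryCLTMacroClosureBarycentricDefs
import HarnessLib

/-!
# Vocabulary of the lead's stub `stub_engine` (line `IdeatorTwoGen1Sketch`, crux `MacroClosure`,
stmt-AtomisticToContinuum-14870): the objects of the barycentric Gronwall

Definitions-only support file extending `CollisionIsometryCLTMacroClosureDefs` /
`CollisionIsometryCLTMacroClosureBarycentricDefs` (namespace `MacroClosureLine`) by the objects in which the
registered sub-goals of `Barycentric.stub_engine` are stated, so that each can land in its own Theorems file:

* the classical state field `Ucl ρ θ u s x = stateOf (ρ s x) (u s x) (θ s x)` and its entropy variables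
  `Lcl σ ρ θ u s x = Dη_σ(Ucl s x)` (a continuous linear form on `State`), with the explicit coefficients
  `lam0` (mass), `lamM = θ⁻¹u` (momentum), `lamE = −θ⁻¹` (energy) of `ThermoChamber` clause 3;
* the tested empirical observable `obs` = `⟨emp w, lam0 + lamM·v + lamE|v|²/2⟩`, its kinetic part `obsK`
  (= the `O` of `CollisionalTransferLocality` at the tests `(ψ, χ) = (lamM, lamE)`), the collisional residual
  `ccRes` (= CTL's `Cc` at those tests, verbatim) and CTL's closure integrand `ccClosure`
  (`(div lamM + ∇lamE·ū) p_c(ρ̄, θ̄)`);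
* the microscopic production `kinFlux` (time-derivative terms + free-transport flux of `obs`), the block
  production `prodBlock` (`∫ₓ ∂ₛΛ·Ū + Σⱼ ∂ⱼΛ·Fⱼ(Ū)`) and the classical production `prodCl`
  (`∫ₓ ∂ₛΛ·U_cl + Σⱼ ∂ⱼΛ·Fⱼ(U_cl)`).

It also lands the registered sub-goal `engine_compat` of `stub_engine`: by the entropy / entropy-flux
compatibility of `ThermoChamber` clause 3, the difference of block and classical production densities is EXACTLY
the pairing of `∂ⱼΛ` with the flux Taylor remainders `fluxRem` (the term the Gronwall has to bound).
Nothing is asserted (every `def` is an object or a statement, never a hypothesis taken as a fact).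
-/

noncomputable section

open MeasureTheory Filter Set Topology InformationTheory
open scoped ENNReal ContDiff

namespace Summit.AtomisticToContinuum.HydrodynamicLimit.Theorems.MacroClosureLine

open Literature.MathematicalPhysics.KineticTheory Literature.Analysis.FluidPDE
open Literature.Analysis.FunctionSpaces

/-! ## The classical state field and its entropy variables -/

/-- The classical conserved state field `U_cl(s,x) = stateOf (ρ s x) (u s x) (θ s x)`. -/
def Ucl (ρ θ : ℝ → T3 → ℝ) (u : ℝ → T3 → V3) (s : ℝ) (x : T3) : State :=
  stateOf (ρ s x) (u s x) (θ s x)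

/-- The entropy-variable field `Λ_cl(s,x) = Dη_σ(U_cl(s,x))` (the `Λ` of `ThermoChamber` clause 3). -/
def Lcl (σ : ℝ) (ρ θ : ℝ → T3 → ℝ) (u : ℝ → T3 → V3) (s : ℝ) (x : T3) : State →L[ℝ] ℝ :=
  fderiv ℝ (hsEntropy σ) (Ucl ρ θ u s x)

/-- Mass entropy variable `λ⁰ = log ρ + f_ex(ρσ³) + ρσ³ f_ex'(ρσ³) − (3/2) log θ − |u|²/(2θ) + 5/2`
(the coefficient of `V.1` in `ThermoChamber` clause 3). -/
def lam0 (σ : ℝ) (ρ θ : ℝ → T3 → ℝ) (u : ℝ → T3 → V3) (s : ℝ) (x : T3) : ℝ :=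
  Real.log (ρ s x) + hsExcessFreeEnergy (ρ s x * σ ^ 3) +
    ρ s x * σ ^ 3 * deriv hsExcessFreeEnergy (ρ s x * σ ^ 3) -
    3 / 2 * Real.log (θ s x) - ‖u s x‖ ^ 2 / (2 * θ s x) + 5 / 2

/-- Momentum entropy variable `λᵐ = θ⁻¹ u` (the test field `ψ` fed to `CollisionalTransferLocality`). -/
def lamM (θ : ℝ → T3 → ℝ) (u : ℝ → T3 → V3) (s : ℝ) (x : T3) : V3 := (θ s x)⁻¹ • u s x

/-- Energy entropy variable `λᴱ = −θ⁻¹` (the test field `χ` fed to `CollisionalTransferLocality`). -/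
def lamE (θ : ℝ → T3 → ℝ) (s : ℝ) (x : T3) : ℝ := -(θ s x)⁻¹

/-! ## Empirical observables -/

section Empirical

variable {n : ℕ}

/-- The tested empirical observable `Obs(s, w) = ⟨emp w, λ⁰(s,x) + λᵐ(s,x)·v + λᴱ(s,x)|v|²/2⟩`
(= `∫ₓ Λ_cl(s,x)·Ū(w,x) dx` up to mollifier commutators). -/
def obs (σ : ℝ) (ρ θ : ℝ → T3 → ℝ) (u : ℝ → T3 → V3) (s : ℝ) (w : Config n (Fin 3) T3) : ℝ :=
  ∫ y, (lam0 σ ρ θ u s y.1 + (∑ j, lamM θ u s y.1 j * y.2 j) + lamE θ s y.1 * (‖y.2‖ ^ 2 / 2))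
    ∂(empiricalMeasure w)

/-- The kinetic part `O(s, w) = ⟨emp w, λᵐ·v + λᴱ|v|²/2⟩` — verbatim the `O` of `CollisionalTransferLocality`
at the tests `(ψ, χ) = (lamM θ u, lamE θ)`. -/
def obsK (θ : ℝ → T3 → ℝ) (u : ℝ → T3 → V3) (s : ℝ) (w : Config n (Fin 3) T3) : ℝ :=
  ∫ y, ((∑ j, lamM θ u s y.1 j * y.2 j) + lamE θ s y.1 * (‖y.2‖ ^ 2 / 2)) ∂(empiricalMeasure w)

/-- The microscopic production `K(s, w)`: the time-derivative terms of `Obs` plus the free-transport flux of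
`Obs` — `⟨emp w, ∂ₛλ⁰ + v·∇λ⁰ + ∂ₛλᵐ·v + ∂ₛλᴱ|v|²/2 + Σⱼₖ ∂ⱼλᵐₖ vⱼvₖ + Σⱼ ∂ⱼλᴱ vⱼ|v|²/2⟩`
(two-sided time derivatives, as in `CollisionalTransferLocality`; they agree with the one-sided ones at
interior times). -/
def kinFlux (σ : ℝ) (ρ θ : ℝ → T3 → ℝ) (u : ℝ → T3 → V3) (s : ℝ) (w : Config n (Fin 3) T3) : ℝ :=
  ∫ y, (Torus.timeDeriv (lam0 σ ρ θ u) s y.1 + (∑ j, y.2 j * Torus.partialDeriv j (lam0 σ ρ θ u s) y.1) +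
      (∑ j, Torus.timeDeriv (lamM θ u) s y.1 j * y.2 j) + Torus.timeDeriv (lamE θ) s y.1 * (‖y.2‖ ^ 2 / 2) +
      (∑ j, ∑ k, Torus.partialDeriv j (fun x => lamM θ u s x k) y.1 * (y.2 j * y.2 k)) +
      ∑ j, Torus.partialDeriv j (lamE θ s) y.1 * (y.2 j * (‖y.2‖ ^ 2 / 2))) ∂(empiricalMeasure w)

/-- CTL's collisional closure integrand at the tests `(lamM, lamE)`: `(div λᵐ + ∇λᴱ·ū) p_c(ρ̄, θ̄)` with
`p_c(r, th) = hsPressure σ r th − r th`. -/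
def ccClosure (σ : ℝ) (θ : ℝ → T3 → ℝ) (u : ℝ → T3 → V3) (φ : T3 → ℝ) (s : ℝ) (w : Config n (Fin 3) T3)
    (x : T3) : ℝ :=
  (Torus.divergence (lamM θ u s) x + ∑ j, Torus.gradient (lamE θ s) x j * bu φ w x j) *
    (hsPressure σ (bρ φ w x) (bθ φ w x) - bρ φ w x * bθ φ w x)

/-- The BLOCK production `∫ₓ [∂ₛΛ_cl(s,x)·Ū(w,x) + Σⱼ ∂ⱼΛ_cl(s,x)·Fⱼ(Ū(w,x))] dx` (one-sided time derivative
within `Ico 0 T`, as in `ThermoChamber` clause 3). -/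
def prodBlock (σ T : ℝ) (ρ θ : ℝ → T3 → ℝ) (u : ℝ → T3 → V3) (φ : T3 → ℝ) (s : ℝ)
    (w : Config n (Fin 3) T3) : ℝ :=
  ∫ x, (Torus.timeDerivWithin (Ico 0 T) (Lcl σ ρ θ u) s x (bU φ w x) +
    ∑ j, Torus.partialDeriv j (Lcl σ ρ θ u s) x (eulerFlux σ j (bU φ w x)))

end Empirical

/-- CTL's collisional residual `Cc(z, τ)` at the tests `(lamM, lamE)` — verbatim the `Cc` of
`CollisionalTransferLocality`: the increment of `O` minus the time-derivative and free-transport terms. -/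
def ccRes (θ : ℝ → T3 → ℝ) (u : ℝ → T3 → V3) {σ : ℝ} {N : ℕ} (Φ : Flow σ N)
    (z : Config (N + 1) (Fin 3) T3) (τ : ℝ) : ℝ :=
  obsK θ u τ (Φ.flow τ z) - obsK θ u 0 (Φ.flow 0 z) -
    ∫ s in Icc 0 τ, ((∫ y, ((∑ j, Torus.timeDeriv (lamM θ u) s y.1 j * y.2 j) +
        Torus.timeDeriv (lamE θ) s y.1 * (‖y.2‖ ^ 2 / 2)) ∂(empiricalMeasure (Φ.flow s z))) +
      deriv (fun r : ℝ => obsK θ u s (freeFlight (Torus.geometry (Fin 3)) r (Φ.flow s z))) 0)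

/-- The CLASSICAL production `∫ₓ [∂ₛΛ_cl(s,x)·U_cl(s,x) + Σⱼ ∂ⱼΛ_cl(s,x)·Fⱼ(U_cl(s,x))] dx`. -/
def prodCl (σ T : ℝ) (ρ θ : ℝ → T3 → ℝ) (u : ℝ → T3 → V3) (s : ℝ) : ℝ :=
  ∫ x, (Torus.timeDerivWithin (Ico 0 T) (Lcl σ ρ θ u) s x (Ucl ρ θ u s x) +
    ∑ j, Torus.partialDeriv j (Lcl σ ρ θ u s) x (eulerFlux σ j (Ucl ρ θ u s x)))

namespace Barycentric

/-- **`engine_compat` (registered sub-goal of `stub_engine`): compatibility kills the linear part.** If the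
entropy variables satisfy `∂ₛΛ·V + Σⱼ ∂ⱼΛ·(DFⱼ(U)V) = 0` for all `V` (clause 3 of `ThermoChamber`), then for
every state `V` the difference of the production densities at `V` and at the classical state `U` is exactly
`Σⱼ ∂ⱼΛ·Rⱼ(V | U)` with the flux Taylor remainder `fluxRem`. [folklore] -/
theorem engine_compat : ∀ (σ : ℝ) (L : State →L[ℝ] ℝ) (Lx : Fin 3 → State →L[ℝ] ℝ) (U V : State),
    (∀ W : State, L W + ∑ j, Lx j (fderiv ℝ (eulerFlux σ j) U W) = 0) →
    (L V + ∑ j, Lx j (eulerFlux σ j V)) - (L U + ∑ j, Lx j (eulerFlux σ j U)) =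
      ∑ j, Lx j (fluxRem σ j V U) := by
  intro σ L Lx U V hcompat
  have h := hcompat (V - U)
  have hrem : ∀ j, Lx j (fluxRem σ j V U) =
      Lx j (eulerFlux σ j V) - Lx j (eulerFlux σ j U) - Lx j (fderiv ℝ (eulerFlux σ j) U (V - U)) := by
    intro j
    simp only [fluxRem, map_sub]
  simp only [hrem, Finset.sum_sub_distrib, map_sub] at h ⊢
  linarith

end Barycentric

end Summit.AtomisticToContinuum.HydrodynamicLimit.Theorems.MacroClosureLine

end
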